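import Literature.NumberTheory.LFunctions.WeilMarkovQuadratic
import Mathlib.Analysis.SpecialFunctions.Trigonometric.DerivHyp
import HarnessLib

/-!
# RiemannHypothesis / GroundBarta — crux `PolarPerronFrobenius` (stmt-RiemannHypothesis-18390):
# small-window Perron–Frobenius, part 2a/3 — the POLAR LOSS and the MASS GAIN of `f ↦ |f|`

Helper file (`--supports`), RH-free, Mathlib + proved tree files only, no definitions.

For a real continuous compactly supported `f = f⁺ − f⁻` on `[-a, a]`, passing to `|f| = f⁺ + f⁻`
* raises the pole form `P(g) = 2|∫g cosh(t/2)|² − 2|∫ g sinh(t/2)|²` of the windowed Weil form by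
  `P(|f|) − P(f) = 8(C⁺C⁻ − S⁺S⁻) ≤ 8 cosh(a) ∫f⁺ ∫f⁻` (`sw_weilPoleForm_abs_sub_le`;
  `0 ≤ C^± = ∫f^± cosh(t/2) ≤ cosh(a/2)∫f^±`, `|S^±| ≤ sinh(a/2)∫f^±`, `cosh² + sinh² = cosh(2·)`), and
* raises the squared total mass by exactly `|∫|f||² − |∫f|² = 4 ∫f⁺ ∫f⁻`
  (`sw_norm_sq_integral_abs_sub_eq`), which is the Beurling–Deny gain of the increment form integrated
  over `(0, 2a]` (`∫₀^{2a} D_t = 4a‖·‖² − |∫·|²`, used in part 2b);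
* and the window threshold `2 cosh a ≤ w(2a) = e^{a}/(2 sinh 2a)` holds for `0 < a ≤ 1/10`
  (`sw_two_cosh_le_weilArchDensity`), so that the gain `4w(2a)∫f⁺∫f⁻` beats the loss.
Prover B, speedrun unit `sr-gb-rung-b` (rung 3).

References: E. Bombieri, Rend. Lincei (9) 11 (2000) Thm 2; H. Yoshida (1992) §6 (6.2) (pole form).
-/

set_option linter.dupNamespace false

noncomputable section

open Set MeasureTheory Filter Complex
open scoped Real Topology

namespace Summit.RiemannHypothesis.RiemannHypothesis.Theorems.PolarPerronFrobenius

open Literature.NumberTheory.LFunctions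

/-! ## Numerics: `2 cosh a ≤ w(2a)` for `0 < a ≤ 1/10` -/

/-- `sinh(1/5) ≤ 1/4` (`e^{1/5} ≤ 1 + 1/5 + 1/25`, `e^{-1/5} ≥ 4/5`). [folklore] -/
theorem sw_sinh_one_fifth_le : Real.sinh (1 / 5) ≤ 1 / 4 := by
  rw [Real.sinh_eq]
  have h1 : Real.exp (1 / 5) ≤ 1 + 1 / 5 + (1 / 5) ^ 2 := by
    have h := Real.abs_exp_sub_one_sub_id_le (x := 1 / 5) (by rw [abs_of_pos (by norm_num)]; norm_num)
    have := (abs_le.1 h).2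
    linarith
  have h2 : 1 - 1 / 5 ≤ Real.exp (-(1 / 5)) := by linarith [Real.add_one_le_exp (-(1 / 5) : ℝ)]
  linarith

/-- **The window threshold**: `2 cosh a ≤ w(2a) = e^{a}/(2 sinh 2a)` for `0 < a ≤ 1/10`
(`4 cosh(a) sinh(2a) ≤ cosh a ≤ e^{a}` since `sinh(2a) ≤ sinh(1/5) ≤ 1/4`; `cosh a ≤ e^a` is
`Literature.NumberTheory.Automorphic.cosh_le_exp_of_nonneg`, re-derived inline to keep the import cone small). [folklore] -/
theorem sw_two_cosh_le_weilArchDensity {a : ℝ} (ha : 0 < a) (ha' : a ≤ 1 / 10) :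
    2 * Real.cosh a ≤ weilArchDensity (2 * a) := by
  unfold weilArchDensity
  have hs : 0 < Real.sinh (2 * a) := Real.sinh_pos_iff.2 (by linarith)
  have hs' : Real.sinh (2 * a) ≤ 1 / 4 :=
    (Real.sinh_le_sinh.2 (by linarith)).trans sw_sinh_one_fifth_le
  have hc : 0 < Real.cosh a := Real.cosh_pos a
  have hce : Real.cosh a ≤ Real.exp a := by
    rw [Real.cosh_eq]
    have : Real.exp (-a) ≤ Real.exp a := Real.exp_le_exp.2 (by linarith)
    linarith
  rw [show 2 * a / 2 = a by ring, le_div_iff₀ (by positivity)]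
  nlinarith

/-! ## Positive and negative parts of a real function -/

section PosNeg

variable {f : ℝ → ℝ} {a : ℝ}

/-- `x = max x 0 − max (-x) 0`. [folklore] -/
theorem sw_self_eq_posPart_sub_negPart (x : ℝ) : x = max x 0 - max (-x) 0 :=
  (max_zero_sub_max_neg_zero_eq_self x).symm

/-- A weighted piece `t ↦ max (±f t) 0 · φ t` of a continuous compactly supported `f` is
integrable (`φ` continuous). [folklore] -/
theorem sw_integrable_posPart_mul (hfc : Continuous f) (hfs : HasCompactSupport f) {φ : ℝ → ℝ}
    (hφ : Continuous φ) : Integrable fun t => max (f t) 0 * φ t := by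
  refine ((hfc.max continuous_const).mul hφ).integrable_of_hasCompactSupport ?_
  refine (hfs.mono ?_).mul_right
  intro t ht
  rw [Function.mem_support] at ht ⊢
  intro h0
  apply ht
  rw [h0, max_self]

/-- Same for the negative part. [folklore] -/
theorem sw_integrable_negPart_mul (hfc : Continuous f) (hfs : HasCompactSupport f) {φ : ℝ → ℝ}
    (hφ : Continuous φ) : Integrable fun t => max (-f t) 0 * φ t := by
  have h := sw_integrable_posPart_mul (f := fun t => -f t) hfc.neg hfs.neg hφ
  exact h

/-- Weighted pairings split along `|f| = f⁺ + f⁻`: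
`∫ |f| φ = ∫ f⁺ φ + ∫ f⁻ φ` (as a complex pairing of real casts). [folklore] -/
theorem sw_integral_abs_mul_eq (hfc : Continuous f) (hfs : HasCompactSupport f) {φ : ℝ → ℝ}
    (hφ : Continuous φ) :
    ∫ t, ((|f t| : ℝ) : ℂ) * ((φ t : ℝ) : ℂ) =
      (((∫ t, max (f t) 0 * φ t) + ∫ t, max (-f t) 0 * φ t : ℝ) : ℂ) := by
  have h1 := sw_integrable_posPart_mul hfc hfs hφ
  have h2 := sw_integrable_negPart_mul hfc hfs hφ
  rw [← integral_add h1 h2, ← integral_complex_ofReal]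
  congr 1 with t
  have habs : |f t| = max (f t) 0 + max (-f t) 0 := by
    rcases le_total 0 (f t) with h | h
    · rw [abs_of_nonneg h, max_eq_left h, max_eq_right (by linarith), add_zero]
    · rw [abs_of_nonpos h, max_eq_right h, max_eq_left (by linarith), zero_add]
  rw [habs]
  push_cast
  ring

/-- `∫ f φ = ∫ f⁺ φ − ∫ f⁻ φ`. [folklore] -/
theorem sw_integral_self_mul_eq (hfc : Continuous f) (hfs : HasCompactSupport f) {φ : ℝ → ℝ}
    (hφ : Continuous φ) :
    ∫ t, ((f t : ℝ) : ℂ) * ((φ t : ℝ) : ℂ) =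
      (((∫ t, max (f t) 0 * φ t) - ∫ t, max (-f t) 0 * φ t : ℝ) : ℂ) := by
  have h1 := sw_integrable_posPart_mul hfc hfs hφ
  have h2 := sw_integrable_negPart_mul hfc hfs hφ
  rw [← integral_sub h1 h2, ← integral_complex_ofReal]
  congr 1 with t
  have := sw_self_eq_posPart_sub_negPart (f t)
  push_cast
  rw [← sub_mul, ← Complex.ofReal_sub, ← this]

/-- `t ↦ max (f t) 0` is integrable for a continuous compactly supported `f`. [folklore] -/
theorem sw_integrable_posPart (hfc : Continuous f) (hfs : HasCompactSupport f) :
    Integrable fun t => max (f t) 0 := by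
  have h := sw_integrable_posPart_mul hfc hfs continuous_const (φ := fun _ => (1 : ℝ))
  simp only [mul_one] at h
  exact h

/-- `∫ f⁺ φ ≤ c ∫ f⁺` when `φ ≤ c` on `[-a, a] ⊇ supp f`. [folklore] -/
theorem sw_integral_posPart_mul_le (hfc : Continuous f) (hfs : HasCompactSupport f)
    (hsupp : Function.support f ⊆ Icc (-a) a) {φ : ℝ → ℝ} (hφ : Continuous φ) {c : ℝ}
    (hφc : ∀ t ∈ Icc (-a) a, φ t ≤ c) :
    ∫ t, max (f t) 0 * φ t ≤ c * ∫ t, max (f t) 0 := by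
  rw [← integral_const_mul]
  refine integral_mono (sw_integrable_posPart_mul hfc hfs hφ)
    ((sw_integrable_posPart hfc hfs).const_mul c) fun t => ?_
  by_cases ht : t ∈ Icc (-a) a
  · dsimp only
    rw [mul_comm c]
    exact mul_le_mul_of_nonneg_left (hφc t ht) (le_max_right _ _)
  · have hf0 : f t = 0 := by
      by_contra h
      exact ht (hsupp (Function.mem_support.2 h))
    simp [hf0]

/-- `|∫ f^+ φ| ≤ c ∫ f⁺` when `|φ| ≤ c` on `[-a, a] ⊇ supp f`. [folklore] -/
theorem sw_abs_integral_posPart_mul_le (hfc : Continuous f) (hfs : HasCompactSupport f)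
    (hsupp : Function.support f ⊆ Icc (-a) a) {φ : ℝ → ℝ} (hφ : Continuous φ) {c : ℝ}
    (hφc : ∀ t ∈ Icc (-a) a, |φ t| ≤ c) :
    |∫ t, max (f t) 0 * φ t| ≤ c * ∫ t, max (f t) 0 := by
  calc |∫ t, max (f t) 0 * φ t| ≤ ∫ t, |max (f t) 0 * φ t| := abs_integral_le_integral_abs
    _ = ∫ t, max (f t) 0 * |φ t| := by
        congr 1 with t
        rw [abs_mul, abs_of_nonneg (le_max_right _ _)]
    _ ≤ c * ∫ t, max (f t) 0 :=
        sw_integral_posPart_mul_le hfc hfs hsupp (φ := fun t => |φ t|) hφ.abs hφc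

end PosNeg

/-! ## The polar loss and the mass gain of `f ↦ |f|` -/

section Gain

variable {f : ℝ → ℝ} {a : ℝ}

/-- **Polar loss**: `P(|f|) − P(f) ≤ 8 cosh(a) ∫f⁺ ∫f⁻` for a real continuous `f` supported in
`[-a, a]`, `a ≥ 0` (`P(|f|) − P(f) = 8(C⁺C⁻ − S⁺S⁻)`, `0 ≤ C^± ≤ cosh(a/2)∫f^±`,
`|S^±| ≤ sinh(a/2)∫f^±`, `cosh² + sinh² = cosh(2·)`). [folklore] -/
theorem sw_weilPoleForm_abs_sub_le (hfc : Continuous f) (hfs : HasCompactSupport f) (ha : 0 ≤ a)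
    (hsupp : Function.support f ⊆ Icc (-a) a) :
    weilPoleForm (fun t => ((|f t| : ℝ) : ℂ)) - weilPoleForm (fun t => ((f t : ℝ) : ℂ)) ≤
      8 * Real.cosh a * (∫ t, max (f t) 0) * ∫ t, max (-f t) 0 := by
  have hcosh : Continuous fun t : ℝ => Real.cosh (t / 2) :=
    Real.continuous_cosh.comp (continuous_id.div_const 2)
  have hsinh : Continuous fun t : ℝ => Real.sinh (t / 2) :=
    Real.continuous_sinh.comp (continuous_id.div_const 2)
  set Cp : ℝ := ∫ t, max (f t) 0 * Real.cosh (t / 2) with hCp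
  set Cm : ℝ := ∫ t, max (-f t) 0 * Real.cosh (t / 2) with hCm
  set Sp : ℝ := ∫ t, max (f t) 0 * Real.sinh (t / 2) with hSp
  set Sm : ℝ := ∫ t, max (-f t) 0 * Real.sinh (t / 2) with hSm
  set Pp : ℝ := ∫ t, max (f t) 0 with hPp
  set Nn : ℝ := ∫ t, max (-f t) 0 with hNn
  -- the four pairings
  have e1 : ∫ t, ((|f t| : ℝ) : ℂ) * (Real.cosh (t / 2) : ℂ) = ((Cp + Cm : ℝ) : ℂ) :=
    sw_integral_abs_mul_eq hfc hfs hcosh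
  have e2 : ∫ t, ((|f t| : ℝ) : ℂ) * (Real.sinh (t / 2) : ℂ) = ((Sp + Sm : ℝ) : ℂ) :=
    sw_integral_abs_mul_eq hfc hfs hsinh
  have e3 : ∫ t, ((f t : ℝ) : ℂ) * (Real.cosh (t / 2) : ℂ) = ((Cp - Cm : ℝ) : ℂ) :=
    sw_integral_self_mul_eq hfc hfs hcosh
  have e4 : ∫ t, ((f t : ℝ) : ℂ) * (Real.sinh (t / 2) : ℂ) = ((Sp - Sm : ℝ) : ℂ) :=
    sw_integral_self_mul_eq hfc hfs hsinh
  have hP : weilPoleForm (fun t => ((|f t| : ℝ) : ℂ)) - weilPoleForm (fun t => ((f t : ℝ) : ℂ)) =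
      8 * (Cp * Cm) - 8 * (Sp * Sm) := by
    unfold weilPoleForm
    rw [e1, e2, e3, e4]
    simp only [Complex.norm_real, Real.norm_eq_abs, sq_abs]
    ring
  rw [hP]
  -- bounds on the pairings
  have hsuppneg : Function.support (fun t => -f t) ⊆ Icc (-a) a := by
    intro t ht; apply hsupp; simpa [Function.mem_support] using ht
  have hcosh_le : ∀ t ∈ Icc (-a) a, Real.cosh (t / 2) ≤ Real.cosh (a / 2) := fun t ht => by
    rw [Real.cosh_le_cosh, abs_of_nonneg (by linarith : 0 ≤ a / 2), abs_le]
    constructor <;> linarith [ht.1, ht.2]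
  have hsinh_le : ∀ t ∈ Icc (-a) a, |Real.sinh (t / 2)| ≤ Real.sinh (a / 2) := fun t ht => by
    rw [abs_le]
    constructor
    · have : Real.sinh (-(a / 2)) ≤ Real.sinh (t / 2) := Real.sinh_le_sinh.2 (by linarith [ht.1])
      rwa [Real.sinh_neg] at this
    · exact Real.sinh_le_sinh.2 (by linarith [ht.2])
  have hPp0 : 0 ≤ Pp := integral_nonneg fun t => le_max_right _ _
  have hNn0 : 0 ≤ Nn := integral_nonneg fun t => le_max_right _ _
  have hCp0 : 0 ≤ Cp := integral_nonneg fun t => mul_nonneg (le_max_right _ _) (Real.cosh_pos _).le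
  have hCm0 : 0 ≤ Cm := integral_nonneg fun t => mul_nonneg (le_max_right _ _) (Real.cosh_pos _).le
  have hCp1 : Cp ≤ Real.cosh (a / 2) * Pp := sw_integral_posPart_mul_le hfc hfs hsupp hcosh hcosh_le
  have hCm1 : Cm ≤ Real.cosh (a / 2) * Nn :=
    sw_integral_posPart_mul_le (f := fun t => -f t) hfc.neg hfs.neg hsuppneg hcosh hcosh_le
  have hSp1 : |Sp| ≤ Real.sinh (a / 2) * Pp :=
    sw_abs_integral_posPart_mul_le hfc hfs hsupp hsinh hsinh_le
  have hSm1 : |Sm| ≤ Real.sinh (a / 2) * Nn :=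
    sw_abs_integral_posPart_mul_le (f := fun t => -f t) hfc.neg hfs.neg hsuppneg hsinh hsinh_le
  have hch : Real.cosh a = Real.cosh (a / 2) ^ 2 + Real.sinh (a / 2) ^ 2 := by
    rw [← Real.cosh_two_mul, show 2 * (a / 2) = a by ring]
  have hc0 : 0 ≤ Real.cosh (a / 2) := (Real.cosh_pos _).le
  have hs0 : 0 ≤ Real.sinh (a / 2) := Real.sinh_nonneg_iff.2 (by linarith)
  have hCC : Cp * Cm ≤ (Real.cosh (a / 2) * Pp) * (Real.cosh (a / 2) * Nn) :=
    mul_le_mul hCp1 hCm1 hCm0 (by positivity)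
  have hSS : -(Sp * Sm) ≤ (Real.sinh (a / 2) * Pp) * (Real.sinh (a / 2) * Nn) := by
    calc -(Sp * Sm) ≤ |Sp * Sm| := neg_le_abs _
      _ = |Sp| * |Sm| := abs_mul _ _
      _ ≤ (Real.sinh (a / 2) * Pp) * (Real.sinh (a / 2) * Nn) :=
          mul_le_mul hSp1 hSm1 (abs_nonneg _) (by positivity)
  rw [hch]
  nlinarith

/-- **Mass gain**: `|∫|f||² − |∫f|² = 4 ∫f⁺ ∫f⁻`. [folklore] -/
theorem sw_norm_sq_integral_abs_sub_eq (hfc : Continuous f) (hfs : HasCompactSupport f) :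
    ‖∫ t, ((|f t| : ℝ) : ℂ)‖ ^ 2 - ‖∫ t, ((f t : ℝ) : ℂ)‖ ^ 2 =
      4 * (∫ t, max (f t) 0) * ∫ t, max (-f t) 0 := by
  have e1 : ∫ t, ((|f t| : ℝ) : ℂ) = (((∫ t, max (f t) 0 * (1 : ℝ)) + ∫ t, max (-f t) 0 * (1 : ℝ) : ℝ) : ℂ) := by
    rw [← sw_integral_abs_mul_eq hfc hfs continuous_const]
    simp only [Complex.ofReal_one, mul_one]
  have e2 : ∫ t, ((f t : ℝ) : ℂ) = (((∫ t, max (f t) 0 * (1 : ℝ)) - ∫ t, max (-f t) 0 * (1 : ℝ) : ℝ) : ℂ) := by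
    rw [← sw_integral_self_mul_eq hfc hfs continuous_const]
    simp only [Complex.ofReal_one, mul_one]
  rw [e1, e2]
  simp only [Complex.norm_real, Real.norm_eq_abs, sq_abs, mul_one]
  ring

end Gain

end Summit.RiemannHypothesis.RiemannHypothesis.Theorems.PolarPerronFrobenius

end
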